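import Summits.HodgeConjecture.HodgeConjecture.Theorems.Ring2WeilCoverageFrameFreePlacementB
import HarnessLib

/-!
# Weil-type family coverage — frame-free placement C: the `2O` eightfold families on `(4, ℚ(√-3), 2)` and a rational frame on the `Dic₁₃` Jacobian

research route conditional on HC_CM; not a corollary; Q11.4-sentence-2 already refuted in dim ≥ 3.

Ring 2, WEIL-TYPE FAMILY-COVERAGE CENSUS (`HOME/WEIL-FAMILY-COVERAGE.md` `## b04`, block b04.10 P.S., owner ring2-b04), third
part of `Ring2WeilCoverageFrameFreePlacement{,B}`.  Two further census sentences with LITERAL invariants: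

* §1 the one-parameter FAMILIES of eightfolds with definite quaternionic multiplication by `ℍ_ℚ ⊗ ℚ(√2)` carried by the
  binary octahedral covers `(0; 3,3,4′,8)` (genus 24), `(0; 3,4′,6,8)` (28), `(0; 4′,4′,4′,8)` (28), `(0; 4,4′,6,8)` (30),
  `(0; 3,4′,8′,2)` (20), `(0; 4′,6,8′,2)` (24) (`k = 2`; frame-free invariants `C = 1/(2¹⁷3⁴), 1/(2¹⁵3⁶), 1/(2¹³3⁸),
  1/(2¹¹3⁸), 1/(2¹³3⁶), 1/(2¹³3⁸)` — every one `≡ 2 (mod ℚ^{×2})`; `R(D₄) = ∅`, `e = 2`, `k` even ⟹ class `= [C]` for every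
  `K`): NON-split on `(4, ℚ(√-d), 2)` for the eleven census fields with `2 ∉ Nm` — the sentence for the first family at
  `ℚ(√-3)` (row `W8.3.2`, the R1 class at `g = 8`) and the generic iff over `d`;
* §2 the HONEST RATIONAL `ℚ(√-2)`-frame `x = g·y₂₆/13` on the `Dic₁₃` JACOBIAN twelvefold `J(C̃₁₂)` (`(0;4,4,13)`):
  exact determinant `q = 53376/2197 = 2⁷·3·139/13³ = 10842·(8/169)²`, and `10842 = 2·3·13·139 ∉ Nm(ℚ(√-2)ˣ)` (descent at
  the inert prime `13 ∥ 10842`) ⟹ `[q] ≠ split 6 2` — the frame-based confirmation of `…FrameFreePlacementB`'s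
  `twelvefold_sqrtNeg2_dic13Jacobian_ne_split` (`C ≡ 13`), owing nothing to the frame-free theorem.

No `def`, no named fact, no `sorry`; nothing here is a statement about Hodge classes; `HC_CM` is used nowhere.

References: [cite: vanGeemen1994HodgeAV, 5.4 and (5.4.1)]; [cite: Serre1973, Ch. III §1].
-/

noncomputable section

set_option linter.dupNamespace false

open Literature.AlgebraicGeometry.Motives
open Literature.AlgebraicGeometry.VanGeemen1994
open Summit.HodgeConjecture.HodgeConjecture.Ring2.Hypotheses

namespace Summit.HodgeConjecture.HodgeConjecture.Ring2.WeilCoverage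

/-! ### §1 The `2O` eightfold family `(0; 3,3,4′,8)`, `C = 1/(2¹⁷·3⁴)` -/

/-- **Frame-free class of the `2O` eightfold family `(0; 3,3,4′,8)` (genus 24, `k = 2`)**: `C = 1/10616832 = 2·(1/(2⁹·3²))²`;
`k` even ⟹ no correction term: the component of `(P_t, K, Θ)` is split iff `2 ∈ Nm(ℚ(√-d)ˣ)`, for every member `t` and
every `K = ℚ(√-d) ⊂ ℍ_ℚ ⊗ ℚ(√2)` (all fifteen census fields embed).
research route conditional on HC_CM; not a corollary; Q11.4-sentence-2 already refuted in dim ≥ 3. [cite: vanGeemen1994HodgeAV, (5.4.1)] -/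
theorem eightfold_octahedralFamily_mk_C_eq_split_iff (d : ℕ) :
    (QuotientGroup.mk (Units.mk0 ((1 : ℚ) / 10616832) (by norm_num)) : weilNormResidueGroup d) =
      splitDiscriminantClass 4 d ↔ Units.mk0 (2 : ℚ) (by norm_num) ∈ normUnitsSubgroup ℚ (weilField d) :=
  mk_eq_split_iff_of_eq_mul_norm_mul_sq (n := 4) (by decide) (a := (1 : ℚ) / 10616832) (C := 2) (ν := 1)
    (s := (1 : ℚ) / (2 ^ 9 * 3 ^ 2)) (by norm_num) (by norm_num) one_ne_zero (by norm_num) (by norm_num)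
    (one_mem_normUnitsSubgroup d)

/-- **The `2O` eightfold family `(0; 3,3,4′,8)` lies on `W8.3.2 = (4, ℚ(√-3), 2)`** — the R1 class at `g = 8` — next to
b04.7's cyclic `ℤ/12`-type families and b04.8's `Q₁₆` families: `[1/10616832] ≠ split 4 3` (`2 ∉ Nm(ℚ(√-3)ˣ)`,
ring2-b02's `two_not_mem_norm_three`).  A positive-dimensional family of Weil-type eightfolds with a curve (genus 24,
`2O`-action) on a non-split row; `W_K` there is OPEN (type III(2) over `ℚ(√2)`; nothing in print).
research route conditional on HC_CM; not a corollary; Q11.4-sentence-2 already refuted in dim ≥ 3. [cite: vanGeemen1994HodgeAV, (5.4.1)] -/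
theorem eightfold_sqrtNeg3_octahedralFamily_ne_split :
    (QuotientGroup.mk (Units.mk0 ((1 : ℚ) / 10616832) (by norm_num)) : weilNormResidueGroup 3) ≠
      splitDiscriminantClass 4 3 := fun h =>
  Summit.HodgeConjecture.Ring2WeilNormDescent.two_not_mem_norm_three ((eightfold_octahedralFamily_mk_C_eq_split_iff 3).1 h)

/-- The same family at `ℚ(√-11)`: row `W8.11.2`. research route conditional on HC_CM; not a corollary; Q11.4-sentence-2 already refuted in dim ≥ 3. [cite: vanGeemen1994HodgeAV, (5.4.1)] -/
theorem eightfold_sqrtNeg11_octahedralFamily_ne_split :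
    (QuotientGroup.mk (Units.mk0 ((1 : ℚ) / 10616832) (by norm_num)) : weilNormResidueGroup 11) ≠
      splitDiscriminantClass 4 11 := fun h =>
  Summit.HodgeConjecture.Ring2WeilNormDescent.two_not_mem_norm_eleven ((eightfold_octahedralFamily_mk_C_eq_split_iff 11).1 h)

/-- The same family at `ℚ(√-19)`, `ℚ(√-43)`, `ℚ(√-67)`, `ℚ(√-163)` (the class-number-one fields with `2` inert), here `ℚ(√-163)`:
row `W8.163.2`. research route conditional on HC_CM; not a corollary; Q11.4-sentence-2 already refuted in dim ≥ 3. [cite: vanGeemen1994HodgeAV, (5.4.1)] -/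
theorem eightfold_sqrtNeg163_octahedralFamily_ne_split :
    (QuotientGroup.mk (Units.mk0 ((1 : ℚ) / 10616832) (by norm_num)) : weilNormResidueGroup 163) ≠
      splitDiscriminantClass 4 163 := fun h =>
  SqrtNeg163.not_mem_2 ((eightfold_octahedralFamily_mk_C_eq_split_iff 163).1 h)

/-- The same family at `ℚ(i)`: SPLIT (`2 = 1² + 1²`), row `W8.1.1`. research route conditional on HC_CM; not a corollary; Q11.4-sentence-2 already refuted in dim ≥ 3. [cite: vanGeemen1994HodgeAV, (5.4.1)] -/
theorem eightfold_sqrtNeg1_octahedralFamily_eq_split :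
    (QuotientGroup.mk (Units.mk0 ((1 : ℚ) / 10616832) (by norm_num)) : weilNormResidueGroup 1) =
      splitDiscriminantClass 4 1 :=
  (eightfold_octahedralFamily_mk_C_eq_split_iff 1).2 SqrtNeg1.mem_2

/-! ### §2 The honest rational `ℚ(√-2)`-frame on the `Dic₁₃` Jacobian twelvefold -/

namespace SqrtNeg2

/-- `10842 = 2·3·13·139 ∉ Nm(ℚ(√-2)ˣ)`: descent at the inert prime `13` (`-2 ≡ 11` is a non-square mod `13`, `13 ∥ 10842`).
research route conditional on HC_CM; not a corollary; Q11.4-sentence-2 already refuted in dim ≥ 3. [cite: Serre1973, Ch. III §1] -/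
theorem not_mem_10842 : Units.mk0 (10842 : ℚ) (by norm_num) ∉ normUnitsSubgroup ℚ (weilField 2) := by
  simpa using natCast_not_mem_normUnitsSubgroup_of_inert (d := 2) (a := 10842) (p := 13)
    (by norm_num) (by decide) (by norm_num) (by norm_num) (by norm_num)

end SqrtNeg2

/-- **`J(C̃₁₂)` is NON-split for `ℚ(√-2)` by an explicit RATIONAL frame** (row `W12.2.13`): on the `Dic₁₃` quaternion piece of the
genus-12 curve `(0; 4,4,13)` the element `x = g·y₂₆/13` (`g` the Gauss sum in `a²`, `y₂₆ ∈ ℤ[Dic₁₃]`, `y₂₆² = -26`) has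
`x² = -2`, `x* = -x`, `K`-signature `(6,6)`, and exact determinant `q = 53376/2197 = 10842 · (8/169)²` with
`10842 ∉ Nm(ℚ(√-2)ˣ)`: `[q] ≠ split 6 2`.  This agrees with the frame-free sentence
`twelvefold_sqrtNeg2_dic13Jacobian_ne_split` (`C ≡ 13`) of part B and owes nothing to the frame-free theorem; on the
triangle point `P₁₃` the same frame gives `4352/169`, SPLIT (part A).
research route conditional on HC_CM; not a corollary; Q11.4-sentence-2 already refuted in dim ≥ 3. [cite: vanGeemen1994HodgeAV, (5.4.1)] -/
theorem twelvefold_sqrtNeg2_dic13Jacobian_mk_ratFrame_ne_split :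
    (QuotientGroup.mk (Units.mk0 ((53376 : ℚ) / 2197) (by norm_num)) : weilNormResidueGroup 2) ≠
      splitDiscriminantClass 6 2 := by
  rw [Ne, mk_eq_split_iff_of_eq_mul_norm_mul_sq (n := 6) (by decide) (a := (53376 : ℚ) / 2197) (C := 10842) (ν := 1)
    (s := (8 : ℚ) / 169) (by norm_num) (by norm_num) one_ne_zero (by norm_num) (by norm_num) SqrtNeg2.mem_1]
  exact SqrtNeg2.not_mem_10842

end Summit.HodgeConjecture.HodgeConjecture.Ring2.WeilCoverage

end
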